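import Summits.CriticalPhenomena.PercolationContinuityZ3.Theorems.PercNearOneGluingNoHeavyLowerTailKnQuestion8PocketOddsStep
import HarnessLib

/-!
# KN Question 8 at three relays — the o-non-pivotal source: the row (Ξ′), EXCH-X′, (club+) and (∗a)

Support file (`--supports stmt-CriticalPhenomena-4575`, closed crux), prover `prim-cplus-coupling` (gen 19).  No definitions, no named
facts, no sorries; standard axioms.  Memo `prim-cplus-coupling/A5-COUPLING-gen19.md`; companion of prim-lf-2's `…KnQuestion8PocketOdds*.lean`
(memo `prim-lf-2/PXI-gen19.md` §6.2–6.3, §9, where (club+) and (∗a) are listed as census-true conjectures).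

Setting (KN Question 8 pocket, memos POCKET-CERT-gen16 §1, PXI-gen19 §0): one finite weighted graph (`μ = prodBernoulli w`), observer `o`,
relays `x, y`, designated relay `z`; `P = {o ↮ x} ∩ {o ↮ y} ∩ {o ↮ z}` (the pocket), `X = {x, y, z pairwise separated}`,
`F = {x ↔ y} ∩ {x ↮ z}`, `E1 = {x ↮ y} ∩ {x ↮ z}`, `E2 = {y ↮ x} ∩ {y ↮ z}`, `W3 = {x ↔ o} ∩ F` (mass `d`), and the split of `W3` by
whether `x` and `y` are joined by an open path AVOIDING `o`:
`A′ = {x ↔ y in ω ∖ (pairs at o)}`, `W3ⁿ = {x ↔ o} ∩ A′ ∩ {x ↮ z}` (o not pivotal), `W3ᵖ = W3 ∖ A′` (o pivotal for `x ↔ y`).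
Masses `a = μ({x↔o} ∩ E1)`, `m_E1 = μ(P ∩ E1)`, `b = μ({y↔o} ∩ E2)`, `c₂ = μ(P ∩ E2)`, `m_F = μ(P ∩ F)`, `pX = μ(P ∩ X)`,
`oX = μ({x↔o} ∩ X)`, `o′X = μ({y↔o} ∩ X)`.

THIS FILE (Part I; everything from ONE positive-association inequality of the edge cluster of `S = {x, y, o}` given `S ↮ z`,
vdBHK Thm 2.1, with the increasing functions `G(C_x)·1_{A′}` and `1{o ↔ {x,y}}` — the event `A′` is increasing in `C_S`):
* `PocketCert.reachable_avoid_of_not_reachable` — if `x ↔ y` and `x ↮ o` then `x ↔ y` avoiding the pairs at `o`;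
* `PocketCert.pocket_nonpivotal_row` — **(Ξ′)**: for every monotone `G ≥ 0` on vertex sets,
  `(d + oX + o′X) · ∫_{P∩F} G(C_x) ≤ (pX + m_F) · ∫_{W3ⁿ} G(C_x)`;
* `PocketCert.pocket_exchX_avoid` — **EXCH-X′**: `(μ(W3ᵖ) + oX + o′X) · m_F ≤ μ(W3ⁿ) · pX` (the case `G ≡ 1`);
Part II (`…KnQuestion8PocketNonPivotalOdds.lean`) derives from these prim-lf-2's conjectures (club+) (PXI-gen19 §6.3) and (∗a) (§6.2).
[cite: VandenbergHaggstromKahn2005, Thm. 2.1 (p. 9), Remark 1 after Thm. 1.2 (p. 5)] [cite: KozmaNitzan2024, Questions 8–9 (§5.5 p. 36)]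
-/

namespace Summit.CriticalPhenomena.PercolationContinuityZ3.Theorems

open MeasureTheory Set Literature.Probability.LatticeModels Literature.Probability.Percolation
open scoped Classical
open KNPreFKG BHK2006

noncomputable section

namespace PocketCert

variable {V : Type*} [Fintype V]

omit [Fintype V] in
/-- If `x ↔ y` and `x ↮ o` then `x` and `y` are joined by an open path using no pair at `o`. [folklore] -/
theorem reachable_avoid_of_not_reachable {ω : BondConfig V} {x y o : V}
    (hxy : (openGraph ω).Reachable x y) (hxo : ¬ (openGraph ω).Reachable x o) :
    (openGraph (ω ∩ {e : Sym2 V | o ∉ e})).Reachable x y := by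
  rw [SimpleGraph.reachable_iff_reflTransGen] at hxy
  induction hxy with
  | refl => exact SimpleGraph.Reachable.refl x
  | tail hzz hadj ih =>
    rename_i z z'
    rcases (openGraph_adj _ z z').1 hadj with ⟨hω, hne⟩
    have hxz : (openGraph ω).Reachable x z := (SimpleGraph.reachable_iff_reflTransGen _ _).2 hzz
    have hxz' : (openGraph ω).Reachable x z' := hxz.trans ((openGraph_adj ω z z').2 ⟨hω, hne⟩).reachable
    have hoz : o ≠ z := fun h => hxo (h ▸ hxz)
    have hoz' : o ≠ z' := fun h => hxo (h ▸ hxz')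
    have hE : s(z, z') ∈ {e : Sym2 V | o ∉ e} := by
      simp only [mem_setOf_eq, Sym2.mem_iff, not_or]
      exact ⟨hoz, hoz'⟩
    exact ih.trans (SimpleGraph.Adj.reachable ((openGraph_adj _ z z').2 ⟨⟨hω, hE⟩, hne⟩))

omit [Fintype V] in
/-- A path avoiding the pairs at `o` is a path. [folklore] -/
theorem reachable_of_reachable_avoid {ω : BondConfig V} {x y o : V}
    (h : (openGraph (ω ∩ {e : Sym2 V | o ∉ e})).Reachable x y) : (openGraph ω).Reachable x y :=
  h.mono (openGraph_mono inter_subset_left)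

/-- **(Ξ′) — the o-non-pivotal row.**  KN Question 8 pocket `P = {o↮x} ∩ {o↮y} ∩ {o↮z}`, `X = {x,y,z pairwise separated}`,
`F = {x↔y} ∩ {x↮z}`, `A′ = {x ↔ y avoiding the pairs at o}`, `W3ⁿ = {x↔o} ∩ A′ ∩ {x↮z}`, `W3 = {x↔o} ∩ F`: for every monotone `G ≥ 0`
on vertex sets, `(μ(W3) + μ({x↔o}∩X) + μ({y↔o}∩X)) · ∫_{P∩F} G(C_x) ≤ (μ(P∩X) + μ(P∩F)) · ∫_{W3ⁿ} G(C_x)`.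
Proof: positive association of the edge cluster of `S = {x,y,o}` given `S ↮ z` (vdBHK Thm 2.1) for the increasing functions
`G(C_x)·1_{A′}` and `1{o ↔ {x,y}}`; on `{S ↮ z}` one has `A′ ∩ {o ↔ {x,y}} = W3ⁿ`, `A′ ∖ {o ↔ {x,y}} = P ∩ F`,
`{o ↔ {x,y}} = W3 ⊔ ({x↔o}∩X) ⊔ ({y↔o}∩X)` and `{o ↮ {x,y}} = (P∩X) ⊔ (P∩F)`.
[cite: VandenbergHaggstromKahn2005, Thm. 2.1 (p. 9)] [cite: KozmaNitzan2024, Questions 8–9 (§5.5 p. 36)] -/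
theorem pocket_nonpivotal_row (w : Sym2 V → unitInterval) (o x y z : V) (G : Set V → ℝ)
    (hG : ∀ S T : Set V, S ⊆ T → G S ≤ G T) (hG0 : ∀ S : Set V, 0 ≤ G S) :
    ((prodBernoulli w).real (openConn x o ∩ openConn x y ∩ {ω | ¬ (openGraph ω).Reachable x z}) +
        (prodBernoulli w).real (openConn x o ∩ ({ω | ¬ (openGraph ω).Reachable x y} ∩ {ω | ¬ (openGraph ω).Reachable x z} ∩
          {ω | ¬ (openGraph ω).Reachable y z})) +
        (prodBernoulli w).real (openConn y o ∩ ({ω | ¬ (openGraph ω).Reachable x y} ∩ {ω | ¬ (openGraph ω).Reachable x z} ∩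
          {ω | ¬ (openGraph ω).Reachable y z}))) *
      ∫ ω in ({ω : BondConfig V | ¬ (openGraph ω).Reachable o x} ∩ {ω | ¬ (openGraph ω).Reachable o y} ∩
            {ω | ¬ (openGraph ω).Reachable o z}) ∩ (openConn x y ∩ {ω | ¬ (openGraph ω).Reachable x z}),
          G (openCluster ω x) ∂(prodBernoulli w) ≤
    ((prodBernoulli w).real (({ω : BondConfig V | ¬ (openGraph ω).Reachable o x} ∩ {ω | ¬ (openGraph ω).Reachable o y} ∩
            {ω | ¬ (openGraph ω).Reachable o z}) ∩ ({ω | ¬ (openGraph ω).Reachable x y} ∩ {ω | ¬ (openGraph ω).Reachable x z} ∩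
          {ω | ¬ (openGraph ω).Reachable y z})) +
        (prodBernoulli w).real (({ω : BondConfig V | ¬ (openGraph ω).Reachable o x} ∩ {ω | ¬ (openGraph ω).Reachable o y} ∩
            {ω | ¬ (openGraph ω).Reachable o z}) ∩ (openConn x y ∩ {ω | ¬ (openGraph ω).Reachable x z}))) *
      ∫ ω in openConn x o ∩ {ω | (openGraph (ω ∩ {e : Sym2 V | o ∉ e})).Reachable x y} ∩ {ω | ¬ (openGraph ω).Reachable x z},
          G (openCluster ω x) ∂(prodBernoulli w) := by
  classical
  set μ := prodBernoulli w with hμ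
  have hmeas : ∀ S' : Set (BondConfig V), MeasurableSet S' := fun _ => MeasurableSet.of_discrete
  have hn := fun (S' : Set (BondConfig V)) => (measureReal_nonneg : 0 ≤ μ.real S')
  have hint : ∀ (g : BondConfig V → ℝ) (S' : Set (BondConfig V)), IntegrableOn g S' μ :=
    fun g S' => (Integrable.of_finite).integrableOn
  set S : Set V := {x, y, o} with hS
  set T : Set V := {z} with hT
  set D : Set (BondConfig V) := {ω : BondConfig V | ∀ s ∈ S, ∀ t ∈ T, ¬ (openGraph ω).Reachable s t} with hD
  set P : Set (BondConfig V) := {ω : BondConfig V | ¬ (openGraph ω).Reachable o x} ∩ {ω | ¬ (openGraph ω).Reachable o y} ∩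
      {ω | ¬ (openGraph ω).Reachable o z} with hP
  set X : Set (BondConfig V) := {ω | ¬ (openGraph ω).Reachable x y} ∩ {ω | ¬ (openGraph ω).Reachable x z} ∩
      {ω | ¬ (openGraph ω).Reachable y z} with hX
  set Fv : Set (BondConfig V) := openConn x y ∩ {ω | ¬ (openGraph ω).Reachable x z} with hFv
  set Av : Set (BondConfig V) := {ω | (openGraph (ω ∩ {e : Sym2 V | o ∉ e})).Reachable x y} with hAv
  set Eo : Set (BondConfig V) := openConn x o ∪ openConn y o with hEo
  set W3 : Set (BondConfig V) := openConn x o ∩ openConn x y ∩ {ω | ¬ (openGraph ω).Reachable x z} with hW3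
  set W3n : Set (BondConfig V) := openConn x o ∩ Av ∩ {ω | ¬ (openGraph ω).Reachable x z} with hW3n
  -- the two monotone functions of the edge cluster of `S`
  set Fe : Set (Sym2 V) → ℝ := fun C =>
    G (openCluster C x) * (if (openGraph (C ∩ {e : Sym2 V | o ∉ e})).Reachable x y then 1 else 0) with hFe
  set Ff : Set (Sym2 V) → ℝ := fun C => if (o ∈ openCluster C x ∨ o ∈ openCluster C y) then 1 else 0 with hFf
  have hFe_mono : Monotone Fe := by
    intro C C' hCC'
    simp only [hFe]
    have hG' : G (openCluster C x) ≤ G (openCluster C' x) := hG _ _ (openCluster_mono hCC' x)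
    by_cases h : (openGraph (C ∩ {e : Sym2 V | o ∉ e})).Reachable x y
    · have h' : (openGraph (C' ∩ {e : Sym2 V | o ∉ e})).Reachable x y :=
        h.mono (openGraph_mono (inter_subset_inter_left _ hCC'))
      rw [if_pos h, if_pos h']; simpa using hG'
    · rw [if_neg h, mul_zero]
      split_ifs
      · simpa using hG0 _
      · simp
  have hFf_mono : Monotone Ff := by
    intro C C' hCC'
    simp only [hFf]
    by_cases h : o ∈ openCluster C x ∨ o ∈ openCluster C y
    · have h' : o ∈ openCluster C' x ∨ o ∈ openCluster C' y :=
        h.imp (fun h1 => openCluster_mono hCC' x h1) (fun h1 => openCluster_mono hCC' y h1)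
      rw [if_pos h, if_pos h']
    · rw [if_neg h]; split_ifs <;> norm_num
  have hxS : x ∈ S := by simp [hS]
  have hyS : y ∈ S := by simp [hS]
  have hclx : ∀ ω : BondConfig V, openCluster (⋃ s ∈ S, openEdgeCluster ω s) x = openCluster ω x := by
    intro ω; ext a; exact (KNSep.reachable_iff_cluster ω S hxS a).symm
  have hcly : ∀ ω : BondConfig V, openCluster (⋃ s ∈ S, openEdgeCluster ω s) y = openCluster ω y := by
    intro ω; ext a; exact (KNSep.reachable_iff_cluster ω S hyS a).symm
  have hAv_iff : ∀ ω : BondConfig V,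
      (openGraph ((⋃ s ∈ S, openEdgeCluster ω s) ∩ {e : Sym2 V | o ∉ e})).Reachable x y ↔ ω ∈ Av := by
    intro ω; rw [hAv, mem_setOf_eq]; exact (KNSep.reachable_inter_iff_cluster ω {e : Sym2 V | o ∉ e} S hxS y).symm
  have hFe_eq : ∀ ω : BondConfig V, Fe (⋃ s ∈ S, openEdgeCluster ω s) = G (openCluster ω x) * Av.indicator 1 ω := by
    intro ω; simp only [hFe, hclx ω]
    by_cases h : ω ∈ Av
    · rw [if_pos ((hAv_iff ω).2 h), indicator_of_mem h]; simp
    · rw [if_neg (fun h' => h ((hAv_iff ω).1 h')), indicator_of_notMem h]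
  have hFf_eq : ∀ ω : BondConfig V, Ff (⋃ s ∈ S, openEdgeCluster ω s) = Eo.indicator 1 ω := by
    intro ω; simp only [hFf, hclx ω, hcly ω]
    by_cases h : o ∈ openCluster ω x ∨ o ∈ openCluster ω y
    · rw [if_pos h, indicator_of_mem (show ω ∈ Eo from h)]; simp
    · rw [if_neg h, indicator_of_notMem (show ω ∉ Eo from h)]
  -- positive association given `D`
  have h1 := BHK2006_setClusterConditionalPositiveAssociation w S T Fe Ff hFe_mono hFf_mono
  simp_rw [hFe_eq, hFf_eq] at h1
  have eprod : ∀ ω : BondConfig V, G (openCluster ω x) * Av.indicator 1 ω * Eo.indicator (1 : BondConfig V → ℝ) ω =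
      G (openCluster ω x) * (Av ∩ Eo).indicator 1 ω := by
    intro ω
    rw [mul_assoc]
    congr 1
    exact (congrFun (Set.inter_indicator_one (s := Av) (t := Eo) (M₀ := ℝ)) ω).symm
  simp_rw [eprod] at h1
  rw [setIntegral_mul_indicator_one μ D Av, setIntegral_indicator_one_eq μ D Eo,
    setIntegral_mul_indicator_one μ D (Av ∩ Eo)] at h1
  -- h1 : (∫_{D∩Av} G) * μ(D∩Eo) ≤ μ D * ∫_{D∩(Av∩Eo)} G
  -- split `D ∩ Av` by `Eo` and `D` by `Eo`
  have hdAv : D ∩ Av = (D ∩ (Av ∩ Eo)) ∪ (D ∩ Av ∩ Eoᶜ) := by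
    ext ω; simp only [mem_inter_iff, mem_union, mem_compl_iff]; tauto
  have hdisjAv : Disjoint (D ∩ (Av ∩ Eo)) (D ∩ Av ∩ Eoᶜ) := by
    rw [Set.disjoint_left]; rintro ω ⟨-, -, h⟩ ⟨-, h'⟩; exact h' h
  have hsplitAv : ∫ ω in D ∩ Av, G (openCluster ω x) ∂μ =
      (∫ ω in D ∩ (Av ∩ Eo), G (openCluster ω x) ∂μ) + ∫ ω in D ∩ Av ∩ Eoᶜ, G (openCluster ω x) ∂μ := by
    have hu := setIntegral_union hdisjAv (hmeas _) (hint (fun ω => G (openCluster ω x)) _)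
      (hint (fun ω => G (openCluster ω x)) _) (μ := μ)
    rw [← hdAv] at hu
    exact hu
  have hsplitD : μ.real D = μ.real (D ∩ Eo) + μ.real (D ∩ Eoᶜ) := by
    have := measureReal_inter_add_sdiff₀ (μ := μ) (s := D) (t := Eo) (hmeas Eo).nullMeasurableSet
    rw [Set.sdiff_eq] at this; linarith
  rw [hsplitAv, hsplitD] at h1
  -- h1 : (I₁ + I₂) * e ≤ (e + e') * I₁, hence I₂ * e ≤ e' * I₁
  have hI1 := setIntegral_nonneg (μ := μ) (hmeas (D ∩ (Av ∩ Eo))) fun ω _ => hG0 (openCluster ω x)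
  have key : (∫ ω in D ∩ Av ∩ Eoᶜ, G (openCluster ω x) ∂μ) * μ.real (D ∩ Eo) ≤
      μ.real (D ∩ Eoᶜ) * ∫ ω in D ∩ (Av ∩ Eo), G (openCluster ω x) ∂μ := by nlinarith [h1, hI1, hn (D ∩ Eo)]
  -- identify the events
  have hDmem : ∀ ω : BondConfig V, ω ∈ D ↔ (¬ (openGraph ω).Reachable x z ∧ ¬ (openGraph ω).Reachable y z ∧
      ¬ (openGraph ω).Reachable o z) := by
    intro ω
    simp only [hD, hS, hT, mem_setOf_eq, mem_insert_iff, mem_singleton_iff, forall_eq_or_imp, forall_eq]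
  have e1 : D ∩ (Av ∩ Eo) = W3n := by
    ext ω
    simp only [mem_inter_iff, mem_union, hDmem, hW3n, hEo, openConn, mem_setOf_eq]
    constructor
    · rintro ⟨⟨hxz, -, -⟩, hav, hxo | hyo⟩
      · exact ⟨⟨hxo, hav⟩, hxz⟩
      · exact ⟨⟨(reachable_of_reachable_avoid hav).trans hyo, hav⟩, hxz⟩
    · rintro ⟨⟨hxo, hav⟩, hxz⟩
      have hxy : (openGraph ω).Reachable x y := reachable_of_reachable_avoid hav
      exact ⟨⟨hxz, fun hyz => hxz (hxy.trans hyz), fun hoz => hxz (hxo.trans hoz)⟩, hav, Or.inl hxo⟩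
  have e2 : D ∩ Av ∩ Eoᶜ = P ∩ Fv := by
    ext ω
    simp only [mem_inter_iff, mem_union, mem_compl_iff, hDmem, hP, hFv, hEo, openConn, mem_setOf_eq, not_or]
    constructor
    · rintro ⟨⟨⟨hxz, -, hoz⟩, hav⟩, hxo, hyo⟩
      exact ⟨⟨⟨fun h => hxo h.symm, fun h => hyo h.symm⟩, hoz⟩, reachable_of_reachable_avoid hav, hxz⟩
    · rintro ⟨⟨⟨hox, hoy⟩, hoz⟩, hxy, hxz⟩
      refine ⟨⟨⟨hxz, fun hyz => hxz (hxy.trans hyz), hoz⟩, ?_⟩, fun h => hox h.symm, fun h => hoy h.symm⟩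
      exact reachable_avoid_of_not_reachable hxy fun h => hox h.symm
  have e3 : D ∩ Eo = W3 ∪ ((openConn x o ∩ X) ∪ (openConn y o ∩ X)) := by
    ext ω
    simp only [mem_inter_iff, mem_union, hDmem, hW3, hX, hEo, openConn, mem_setOf_eq]
    constructor
    · rintro ⟨⟨hxz, hyz, -⟩, hxo | hyo⟩
      · by_cases hxy : (openGraph ω).Reachable x y
        · exact Or.inl ⟨⟨hxo, hxy⟩, hxz⟩
        · exact Or.inr (Or.inl ⟨hxo, ⟨hxy, hxz⟩, hyz⟩)
      · by_cases hxy : (openGraph ω).Reachable x y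
        · exact Or.inl ⟨⟨hxy.trans hyo, hxy⟩, hxz⟩
        · exact Or.inr (Or.inr ⟨hyo, ⟨hxy, hxz⟩, hyz⟩)
    · rintro (⟨⟨hxo, hxy⟩, hxz⟩ | ⟨hxo, ⟨hxy, hxz⟩, hyz⟩ | ⟨hyo, ⟨hxy, hxz⟩, hyz⟩)
      · exact ⟨⟨hxz, fun hyz => hxz (hxy.trans hyz), fun hoz => hxz (hxo.trans hoz)⟩, Or.inl hxo⟩
      · exact ⟨⟨hxz, hyz, fun hoz => hxz (hxo.trans hoz)⟩, Or.inl hxo⟩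
      · exact ⟨⟨hxz, hyz, fun hoz => hyz (hyo.trans hoz)⟩, Or.inr hyo⟩
  have hdisj1 : Disjoint (openConn x o ∩ X) (openConn y o ∩ X) := by
    rw [Set.disjoint_left]
    rintro ω ⟨hxo, ⟨hxy, -⟩, -⟩ ⟨hyo, -⟩
    exact hxy (hxo.trans hyo.symm)
  have hdisj2 : Disjoint W3 ((openConn x o ∩ X) ∪ (openConn y o ∩ X)) := by
    rw [Set.disjoint_left]
    rintro ω ⟨⟨-, hxy⟩, -⟩ (⟨-, ⟨hxy', -⟩, -⟩ | ⟨-, ⟨hxy', -⟩, -⟩) <;> exact hxy' hxy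
  have e3m : μ.real (D ∩ Eo) = μ.real W3 + μ.real (openConn x o ∩ X) + μ.real (openConn y o ∩ X) := by
    rw [e3, measureReal_union hdisj2 (hmeas _), measureReal_union hdisj1 (hmeas _)]; ring
  have e4 : D ∩ Eoᶜ = (P ∩ X) ∪ (P ∩ Fv) := by
    ext ω
    simp only [mem_inter_iff, mem_union, mem_compl_iff, hDmem, hP, hX, hFv, hEo, openConn, mem_setOf_eq, not_or]
    constructor
    · rintro ⟨⟨hxz, hyz, hoz⟩, hxo, hyo⟩
      by_cases hxy : (openGraph ω).Reachable x y
      · exact Or.inr ⟨⟨⟨fun h => hxo h.symm, fun h => hyo h.symm⟩, hoz⟩, hxy, hxz⟩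
      · exact Or.inl ⟨⟨⟨fun h => hxo h.symm, fun h => hyo h.symm⟩, hoz⟩, ⟨hxy, hxz⟩, hyz⟩
    · rintro (⟨⟨⟨hox, hoy⟩, hoz⟩, ⟨hxy, hxz⟩, hyz⟩ | ⟨⟨⟨hox, hoy⟩, hoz⟩, hxy, hxz⟩)
      · exact ⟨⟨hxz, hyz, hoz⟩, fun h => hox h.symm, fun h => hoy h.symm⟩
      · exact ⟨⟨hxz, fun hyz => hxz (hxy.trans hyz), hoz⟩, fun h => hox h.symm, fun h => hoy h.symm⟩
  have hdisj3 : Disjoint (P ∩ X) (P ∩ Fv) := by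
    rw [Set.disjoint_left]
    rintro ω ⟨-, ⟨hxy, -⟩, -⟩ ⟨-, hxy', -⟩
    exact hxy hxy'
  have e4m : μ.real (D ∩ Eoᶜ) = μ.real (P ∩ X) + μ.real (P ∩ Fv) := by
    rw [e4, measureReal_union hdisj3 (hmeas _)]
  rw [e1, e2, e3m, e4m] at key
  linarith [key]

/-- **EXCH-X′** (the case `G ≡ 1` of `pocket_nonpivotal_row`, with `μ(W3) = μ(W3ⁿ) + μ(W3ᵖ)`): with the events of that theorem and
`W3ᵖ = {x↔o} ∩ {x↔y} ∩ A′ᶜ ∩ {x↮z}` (o pivotal for `x ↔ y`),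
`(μ(W3ᵖ) + μ({x↔o}∩X) + μ({y↔o}∩X)) · μ(P∩F) ≤ μ(W3ⁿ) · μ(P∩X)`.
[cite: VandenbergHaggstromKahn2005, Thm. 2.1 (p. 9)] [cite: KozmaNitzan2024, Questions 8–9 (§5.5 p. 36)] -/
theorem pocket_exchX_avoid (w : Sym2 V → unitInterval) (o x y z : V) :
    ((prodBernoulli w).real (openConn x o ∩ openConn x y ∩ {ω | ¬ (openGraph (ω ∩ {e : Sym2 V | o ∉ e})).Reachable x y} ∩
          {ω | ¬ (openGraph ω).Reachable x z}) +
        (prodBernoulli w).real (openConn x o ∩ ({ω | ¬ (openGraph ω).Reachable x y} ∩ {ω | ¬ (openGraph ω).Reachable x z} ∩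
          {ω | ¬ (openGraph ω).Reachable y z})) +
        (prodBernoulli w).real (openConn y o ∩ ({ω | ¬ (openGraph ω).Reachable x y} ∩ {ω | ¬ (openGraph ω).Reachable x z} ∩
          {ω | ¬ (openGraph ω).Reachable y z}))) *
      (prodBernoulli w).real (({ω : BondConfig V | ¬ (openGraph ω).Reachable o x} ∩ {ω | ¬ (openGraph ω).Reachable o y} ∩
            {ω | ¬ (openGraph ω).Reachable o z}) ∩ (openConn x y ∩ {ω | ¬ (openGraph ω).Reachable x z})) ≤
    (prodBernoulli w).real (openConn x o ∩ {ω | (openGraph (ω ∩ {e : Sym2 V | o ∉ e})).Reachable x y} ∩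
          {ω | ¬ (openGraph ω).Reachable x z}) *
      (prodBernoulli w).real (({ω : BondConfig V | ¬ (openGraph ω).Reachable o x} ∩ {ω | ¬ (openGraph ω).Reachable o y} ∩
            {ω | ¬ (openGraph ω).Reachable o z}) ∩ ({ω | ¬ (openGraph ω).Reachable x y} ∩ {ω | ¬ (openGraph ω).Reachable x z} ∩
          {ω | ¬ (openGraph ω).Reachable y z})) := by
  classical
  set μ := prodBernoulli w with hμ
  have hmeas : ∀ S' : Set (BondConfig V), MeasurableSet S' := fun _ => MeasurableSet.of_discrete
  have hn := fun (S' : Set (BondConfig V)) => (measureReal_nonneg : 0 ≤ μ.real S')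
  have h := pocket_nonpivotal_row w o x y z (fun _ => (1 : ℝ)) (fun _ _ _ => le_rfl) (fun _ => zero_le_one)
  simp only [setIntegral_const, smul_eq_mul, mul_one] at h
  change (μ.real (openConn x o ∩ openConn x y ∩ {ω | ¬ (openGraph ω).Reachable x z}) +
      μ.real (openConn x o ∩ ({ω | ¬ (openGraph ω).Reachable x y} ∩ {ω | ¬ (openGraph ω).Reachable x z} ∩
          {ω | ¬ (openGraph ω).Reachable y z})) +
      μ.real (openConn y o ∩ ({ω | ¬ (openGraph ω).Reachable x y} ∩ {ω | ¬ (openGraph ω).Reachable x z} ∩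
          {ω | ¬ (openGraph ω).Reachable y z}))) *
      μ.real (({ω : BondConfig V | ¬ (openGraph ω).Reachable o x} ∩ {ω | ¬ (openGraph ω).Reachable o y} ∩
            {ω | ¬ (openGraph ω).Reachable o z}) ∩ (openConn x y ∩ {ω | ¬ (openGraph ω).Reachable x z})) ≤
    (μ.real (({ω : BondConfig V | ¬ (openGraph ω).Reachable o x} ∩ {ω | ¬ (openGraph ω).Reachable o y} ∩
            {ω | ¬ (openGraph ω).Reachable o z}) ∩ ({ω | ¬ (openGraph ω).Reachable x y} ∩ {ω | ¬ (openGraph ω).Reachable x z} ∩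
          {ω | ¬ (openGraph ω).Reachable y z})) +
      μ.real (({ω : BondConfig V | ¬ (openGraph ω).Reachable o x} ∩ {ω | ¬ (openGraph ω).Reachable o y} ∩
            {ω | ¬ (openGraph ω).Reachable o z}) ∩ (openConn x y ∩ {ω | ¬ (openGraph ω).Reachable x z}))) *
      μ.real (openConn x o ∩ {ω | (openGraph (ω ∩ {e : Sym2 V | o ∉ e})).Reachable x y} ∩
          {ω | ¬ (openGraph ω).Reachable x z}) at h
  -- split W3 = W3ⁿ ⊔ W3ᵖ
  set Av : Set (BondConfig V) := {ω | (openGraph (ω ∩ {e : Sym2 V | o ∉ e})).Reachable x y} with hAv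
  have hW : μ.real (openConn x o ∩ openConn x y ∩ {ω | ¬ (openGraph ω).Reachable x z}) =
      μ.real (openConn x o ∩ Av ∩ {ω | ¬ (openGraph ω).Reachable x z}) +
        μ.real (openConn x o ∩ openConn x y ∩ {ω | ¬ (openGraph (ω ∩ {e : Sym2 V | o ∉ e})).Reachable x y} ∩
          {ω | ¬ (openGraph ω).Reachable x z}) := by
    have hh := measureReal_inter_add_sdiff₀ (μ := μ) (s := openConn x o ∩ openConn x y ∩ {ω | ¬ (openGraph ω).Reachable x z})
      (t := Av) (hmeas Av).nullMeasurableSet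
    have ea : openConn x o ∩ openConn x y ∩ {ω | ¬ (openGraph ω).Reachable x z} ∩ Av =
        openConn x o ∩ Av ∩ {ω | ¬ (openGraph ω).Reachable x z} := by
      ext ω
      simp only [mem_inter_iff, hAv, openConn, mem_setOf_eq]
      constructor
      · rintro ⟨⟨⟨hxo, -⟩, hxz⟩, hav⟩; exact ⟨⟨hxo, hav⟩, hxz⟩
      · rintro ⟨⟨hxo, hav⟩, hxz⟩; exact ⟨⟨⟨hxo, reachable_of_reachable_avoid hav⟩, hxz⟩, hav⟩
    have eb : (openConn x o ∩ openConn x y ∩ {ω | ¬ (openGraph ω).Reachable x z}) \ Av =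
        openConn x o ∩ openConn x y ∩ {ω | ¬ (openGraph (ω ∩ {e : Sym2 V | o ∉ e})).Reachable x y} ∩
          {ω | ¬ (openGraph ω).Reachable x z} := by
      ext ω
      simp only [mem_inter_iff, mem_sdiff, hAv, openConn, mem_setOf_eq]
      tauto
    rw [ea, eb] at hh; linarith
  rw [hW] at h
  nlinarith [h, hn (openConn x o ∩ Av ∩ {ω | ¬ (openGraph ω).Reachable x z}),
    hn (({ω : BondConfig V | ¬ (openGraph ω).Reachable o x} ∩ {ω | ¬ (openGraph ω).Reachable o y} ∩
            {ω | ¬ (openGraph ω).Reachable o z}) ∩ (openConn x y ∩ {ω | ¬ (openGraph ω).Reachable x z}))]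

end PocketCert

end

end Summit.CriticalPhenomena.PercolationContinuityZ3.Theorems
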